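import Summits.Langlands.Langlands.Theses.StickelbergerDial
import Summits.Langlands.Langlands.Theses.PrimeSwitchSplit
import Summits.Langlands.Langlands.Theorems.StickelbergerDialSectorComplement
import Summits.Langlands.Langlands.Theorems.SectorComplement.Negative.RepeatedRootSocleVacuity
import Summits.Langlands.Langlands.Theorems.SectorComplement.Negative.StickelbergerDialGaloisSideInSummit

/-!
# STRATEGY CENSUS (Lean part) — `StickelbergerDial.SectorComplement` (stmt-Langlands-17964)

Crux-strategist r1 (EXEMPT-46 re-exam, bin RESTATED), planner-cstrat-stmt-Langlands-17964-r1-0,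
2026-08-17.  `C := SectorComplement := WeightZeroNonOrdinaryPA → _root_.Langlands` (X := the route
target `WeightZeroNonOrdinaryPA`, S := `_root_.Langlands`).

§0  logical position of C (and why the gate's unconditional `restated` stamp is a short-name
    collision with `RepeatedRootSocle.SectorComplement`);
§D1 ATLAS ADOPTION — C from the six typed pieces of route PrimeSwitchSplit (assembly proved; X is
    provably decorative);
§D2 CELL CARVE — the only shape in which X is consumed: a descent piece `X → B_w|cell` plus the
    typed remainder (assembly proved);
§D4 DIRECTIONAL split (A) ∧ (X → (B)) ∧ CRD (assembly proved; the X-piece is (B) again under X);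
§D5 RANK split (rank 1 ∧ (X → ranks ≥ 2)) (assembly proved; the X-piece is C minus a sliver).
Probes (`piece → S`, `piece → C` by `first | exact? | simpa | aesop`) live in `bc/Probes*.lean`.
Nothing here asserts C, X or S.
-/

set_option linter.dupNamespace false

namespace Summit.Langlands.Langlands.Cruxes.SectorComplement.CensusStickelbergerDial

open Filter
open Summit.Langlands
open Summit.Langlands.Langlands.Theses
open Summit.Langlands.Langlands.Theses.StickelbergerDial
open Summit.Langlands.Langlands.Theses.PrimeSwitchSplit (WeakGeometricAutomorphy
  SatakeAvatarExistence PadicMemberCompatibility CompatibilityAwayFromLR CanonicalReciprocityData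
  AvatarConjugacy)

/-! ## §0 Position -/

/-- `S → C`: C is WEAKER than the summit, not "at least as strong". -/
theorem pos_sectorComplement_of_langlands : _root_.Langlands → SectorComplement := fun h _ => h

/-- Under X, `C ↔ S` (landed as `stickelbergerDial_sectorComplement_iff_of_target`, p157994). -/
theorem pos_iff_of_target (hX : WeightZeroNonOrdinaryPA) : SectorComplement ↔ _root_.Langlands :=
  Summit.Langlands.Langlands.Theorems.stickelbergerDial_sectorComplement_iff_of_target hX

/-- An UNCONDITIONAL `C ↔ S` for THIS decl is exactly as strong as `X ∨ S`: it would decide the open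
target or the summit.  So no unconditional iff can be landed short of proving X (or S). -/
theorem pos_unconditional_iff_iff_target_or_summit :
    (SectorComplement ↔ _root_.Langlands) ↔ (WeightZeroNonOrdinaryPA ∨ _root_.Langlands) := by
  constructor
  · intro h
    by_cases hX : WeightZeroNonOrdinaryPA
    · exact Or.inl hX
    · exact Or.inr (h.mp fun hX' => absurd hX' hX)
  · rintro (hX | hS)
    · exact ⟨fun hC => hC hX, fun hS _ => hS⟩
    · exact ⟨fun _ => hS, fun hS _ => hS⟩

/-- COLLISION RECORD.  The theorem the gate's `restated` stamp on route-Langlands-StickelbergerDial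
cites (test "(i) unconditional with no siblings", 2026-08-17T12:41:51Z) is about the HOMONYMOUS decl
of route `RepeatedRootSocle` (item stmt-Langlands-18089, whose target is vacuous), not about this
item: it elaborates at that type … -/
example : RepeatedRootSocle.SectorComplement ↔ _root_.Langlands :=
  Summit.Langlands.Langlands.Theorems.SectorComplement.Negative.sectorComplement_iff_langlands

/-- … and transporting it to THIS decl would require `X ∨ S` (previous theorem); the two decls are
different closed Props (`UnrefinedWeightTwoLifting → S` vs `WeightZeroNonOrdinaryPA → S`). -/
example : (RepeatedRootSocle.SectorComplement ↔ _root_.Langlands) →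
    ((StickelbergerDial.SectorComplement ↔ _root_.Langlands) ↔
      (WeightZeroNonOrdinaryPA ∨ _root_.Langlands)) :=
  fun _ => pos_unconditional_iff_iff_target_or_summit

/-! ## §D1 Atlas adoption (X-free): the six typed pieces of `PrimeSwitchSplit` -/

/-- (b) assembly PROVED, one line on top of `PrimeSwitchSplit.closes` (`trivial_seam`).  Note the
binder `_hX`: X is NOT consumed. -/
theorem d1_sectorComplement_of_atlas (hB : WeakGeometricAutomorphy) (hW : SatakeAvatarExistence)
    (hP : PadicMemberCompatibility) (hA : CompatibilityAwayFromLR) (hR : CanonicalReciprocityData)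
    (hU : AvatarConjugacy) : SectorComplement :=
  fun _hX => PrimeSwitchSplit.closes hB hW hP hA hR hU

/-- X, the door `UnramifiedFermatWitness` and the engine `FLLiftingWeightZero` are DECORATIVE in D1:
the same six leaves give the summit with none of them. -/
theorem d1_langlands_of_atlas_without_route (hB : WeakGeometricAutomorphy)
    (hW : SatakeAvatarExistence) (hP : PadicMemberCompatibility) (hA : CompatibilityAwayFromLR)
    (hR : CanonicalReciprocityData) (hU : AvatarConjugacy) : _root_.Langlands :=
  PrimeSwitchSplit.closes hB hW hP hA hR hU

/-! ## §D2 Cell carve: the one shape in which X is consumed -/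

/-- `B_w|cell` — WEAK (Satake-level) automorphy over the BASE CM field `K` on X's own cell
(X's hypotheses verbatim, minus the auxiliary field `Kav`; conclusion = that of
`WeakGeometricAutomorphy`).  Actual, not potential. -/
def WeakAutomorphyOnCell : Prop :=
  ∀ (K : Type) [Field K] [NumberField K], NumberField.IsCMField K → ∀ (n : ℕ), 2 ≤ n → ∀ (ℓ : ℕ) [Fact ℓ.Prime], n ^ 2 < ℓ → 2 * n < ℓ → Algebra.IsUnramifiedIn (NumberField.RingOfIntegers K) (Ideal.span {(ℓ : ℤ)}) → ∀ (ι : PadicAlgCl ℓ ≃+* ℂ) (r : Literature.NumberTheory.GaloisRepresentations.FramedGaloisRep K (PadicAlgCl ℓ) n) (τ : Field.absoluteGaloisGroup K →* GL (Fin n) (Literature.NumberTheory.GaloisRepresentations.padicAlgClResidueField ℓ)), (∀ᶠ v in cofinite, r.IsUnramifiedAt v) → (∀ (v : IsDedekindDomain.HeightOneSpectrum (NumberField.RingOfIntegers K)) (hv : ((ℓ : ℕ) : NumberField.RingOfIntegers K) ∈ v.asIdeal), let D := Literature.NumberTheory.PAdicHodge.fontainePstAdicCompletion v ℓ hv; D.IsCrystallineFramed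 (r.toLocal v) ∧ (letI := D.algebra; ∀ τ' : v.adicCompletion K →ₐ[ℚ_[ℓ]] PadicAlgCl ℓ, r.labelledHodgeTateWeightsAt v D.algebra D.𝔅 τ'.toRingHom = (Multiset.range n).map fun i : ℕ => (i : ℤ))) → r.IsResidualRepOf (RingHom.id _) τ → Literature.NumberTheory.GaloisRepresentations.IsAbsIrreducible τ → Literature.NumberTheory.GaloisRepresentations.IsDecomposedGeneric τ → Literature.NumberTheory.GaloisRepresentations.IsAbsIrreducible (τ.comp (Literature.NumberTheory.GaloisRepresentations.absGaloisGroupAdjoinRootsOfUnity K ℓ).subtype) → Literature.NumberTheory.GaloisRepresentations.Subgroup.IsEnormous ((Literature.NumberTheory.GaloisRepresentations.absGaloisGroupAdjoinRootsOfUnity K ℓ).map τ) → (∃ σ : Field.absoluteGaloisGroup K, σ ∉ Literature.NumberTheory.GaloisRepresentations.absGaloisGroupAdjoinRootsOfUnity K ℓ ∧ ∃ c : Literature.NumberTheory.GaloisRepresentations.padicAlgClResidueField ℓ, (τ σ).1 = c • 1) → ∀ (hcpt : Literature.NumberTheory.Automorphic.isCompact_glFiniteIntegralLevel n K), ∃ π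 : Literature.NumberTheory.Automorphic.CuspidalAutomorphicRepData n K hcpt, π.1.IsLAlgebraic ∧ ∀ᶠ v : IsDedekindDomain.HeightOneSpectrum (NumberField.RingOfIntegers K) in cofinite, Summit.Langlands.SatakeFrobCompatibleAt ι π.1 r v

/-- The X-consuming piece: potential (over some CM Galois `K'/K`, HLTT-normalised, weight 0) ⇒
actual Satake-level automorphy over `K` on the cell = NON-SOLVABLE DESCENT of automorphy for
`GL_n` over CM fields (SolvableImageBarrier province; no published approach). -/
def DescentOnCell : Prop := WeightZeroNonOrdinaryPA → WeakAutomorphyOnCell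

/-- The typed remainder of `B_w` once the cell is granted. -/
def WeakAutomorphyOffCell : Prop := WeakAutomorphyOnCell → WeakGeometricAutomorphy

/-- (b) assembly PROVED: X enters through `hD` only. -/
theorem d2_sectorComplement_of_cellCarve (hD : DescentOnCell) (hOff : WeakAutomorphyOffCell)
    (hW : SatakeAvatarExistence) (hP : PadicMemberCompatibility) (hA : CompatibilityAwayFromLR)
    (hR : CanonicalReciprocityData) (hU : AvatarConjugacy) : SectorComplement :=
  fun hX => PrimeSwitchSplit.closes (hOff (hD hX)) hW hP hA hR hU

/-- `B_w` itself gives both carve pieces (so D2 is `B_w` re-cut along a set of ρ of "measure zero":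
fixed labelled weights `{0,…,n-1}`, `ℓ > n²` unramified, residually enormous). -/
theorem d2_pieces_of_weakGeometricAutomorphy (hB : WeakGeometricAutomorphy) :
    DescentOnCell ∧ WeakAutomorphyOffCell := by
  refine ⟨?_, fun _ => hB⟩
  intro _ K _ _ _ n hn ℓ _ _ _ _ ι r _ hur hcr hres habs _ _ _ _ hcpt
  have h0 : 0 < n := by omega
  exact hB K n hcpt h0 ℓ ι r
    (Summit.Langlands.Langlands.Theorems.SectorComplement.Negative.isIrreducible_of_isResidualRepOf
      h0 r hres habs)
    ⟨hur, fun v hv => (hcr v hv).1.isDeRhamFramed⟩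

/-! ## §D4 Directional split -/

/-- Direction (A) of the summit, all fields / data / ranks. -/
def DirA : Prop :=
  ∀ (F : Type) [Field F] [NumberField F] (𝓡 : ReciprocityData F) (n : ℕ), 0 < n →
    ∀ hcpt : Literature.NumberTheory.Automorphic.isCompact_glFiniteIntegralLevel n F,
      AutomorphicToGalois n 𝓡 hcpt

/-- Direction (B) of the summit, all fields / data / ranks. -/
def DirB : Prop :=
  ∀ (F : Type) [Field F] [NumberField F] (𝓡 : ReciprocityData F) (n : ℕ), 0 < n →
    ∀ hcpt : Literature.NumberTheory.Automorphic.isCompact_glFiniteIntegralLevel n F,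
      GaloisToAutomorphic n 𝓡 hcpt

/-- The X-piece of the directional split: (B) from X. -/
def DirBOfTarget : Prop := WeightZeroNonOrdinaryPA → DirB

/-- (b) assembly PROVED. -/
theorem d4_sectorComplement_of_directions (hA : DirA) (hB : DirBOfTarget)
    (hR : CanonicalReciprocityData) : SectorComplement := by
  intro hX F _ _
  exact ⟨hR F, fun 𝓡 n hn hcpt => ⟨hA F 𝓡 n hn hcpt, hB hX F 𝓡 n hn hcpt⟩⟩

/-- … but the X-piece is the frame disease one level down: `DirB → DirBOfTarget` and, under X,
`DirBOfTarget ↔ DirB` — its only plan is (B) itself. -/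
theorem d4_dirBOfTarget_iff_of_target (hX : WeightZeroNonOrdinaryPA) : DirBOfTarget ↔ DirB :=
  ⟨fun h => h hX, fun h _ => h⟩

theorem d4_pieces_of_langlands (hS : _root_.Langlands) :
    DirA ∧ DirBOfTarget ∧ CanonicalReciprocityData := by
  refine ⟨?_, ?_, ?_⟩
  · intro F _ _ 𝓡 n hn hcpt
    exact ((hS F).2 𝓡 n hn hcpt).1
  · intro _ F _ _ 𝓡 n hn hcpt
    exact ((hS F).2 𝓡 n hn hcpt).2
  · intro F _ _
    exact (hS F).1

/-! ## §D5 Rank split -/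

/-- The summit at one rank `n`. -/
def LanglandsAtRank (n : ℕ) : Prop :=
  ∀ (F : Type) [Field F] [NumberField F] (𝓡 : ReciprocityData F)
    (hcpt : Literature.NumberTheory.Automorphic.isCompact_glFiniteIntegralLevel n F),
      GlobalLanglandsCorrespondenceGLn n F 𝓡 hcpt

/-- Rank one (class field theory province; largely in tree: `RankOne*.lean`). -/
def RankOnePiece : Prop := LanglandsAtRank 1

/-- The X-piece of the rank split: every rank ≥ 2 from X — i.e. C minus the rank-one sliver. -/
def HigherRankJunction : Prop := WeightZeroNonOrdinaryPA → ∀ n, 2 ≤ n → LanglandsAtRank n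

/-- (b) assembly PROVED. -/
theorem d5_sectorComplement_of_ranks (h1 : RankOnePiece) (h2 : HigherRankJunction)
    (hR : CanonicalReciprocityData) : SectorComplement := by
  intro hX F _ _
  refine ⟨hR F, fun 𝓡 n hn hcpt => ?_⟩
  rcases Nat.lt_or_ge n 2 with h | h
  · obtain rfl : n = 1 := by omega
    exact h1 F 𝓡 hcpt
  · exact h2 hX n h F 𝓡 hcpt

/-- … and the X-piece is again the frame one level down. -/
theorem d5_higherRankJunction_iff_of_target (hX : WeightZeroNonOrdinaryPA) :
    HigherRankJunction ↔ ∀ n, 2 ≤ n → LanglandsAtRank n :=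
  ⟨fun h => h hX, fun h _ => h⟩

/-- Both rank pieces are consequences of the summit (so, like every piece above, they are at most
S and the probes `piece → S` can only fail or prove S outright). -/
theorem d5_pieces_of_langlands (hS : _root_.Langlands) : RankOnePiece ∧ HigherRankJunction := by
  refine ⟨?_, ?_⟩
  · intro F _ _ 𝓡 hcpt
    exact (hS F).2 𝓡 1 Nat.one_pos hcpt
  · intro _ n hn F _ _ 𝓡 hcpt
    exact (hS F).2 𝓡 n (by omega) hcpt

end Summit.Langlands.Langlands.Cruxes.SectorComplement.CensusStickelbergerDial
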